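import Literature.AlgebraicGeometry.Motives.AbelianVarietyGoodReductionHomCofinite
import Literature.AlgebraicGeometry.Motives.AbelianVarietyGoodReductionConjugate
import Literature.AlgebraicGeometry.Motives.AbelianVarietyGoodReductionProducedGroup
import HarnessLib

/-!
# Reduction of homomorphisms at all but finitely many places, with the Frobenius-conjugate companions (`FactRH′`)

Topic `Literature/AlgebraicGeometry/Motives`; namespace `Literature.AlgebraicGeometry.Motives`, grouping sub-namespace
`AbelianVariety`.  THEOREMS ONLY (no definition, no named fact, no instance; net Literature debt 0).  Sequel of
`AbelianVarietyGoodReductionHomCofinite` (reduction of homomorphisms for PRODUCED good-reduction data) and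
`AbelianVarietyGoodReductionConjugate` (the Frobenius-conjugate datum `GoodReductionAt.conjFrob`); cell `hodgecm-mathlib`
(D-0151), row II-1, the SINGLE reduction antecedent `FactRH′` of the `S7a` composition of the main theorem of complex
multiplication ([Shimura1998] §18.6), COMPANIONS edition.

In the proof of [Shimura1998] Thm. 18.6 (pp. 126–127, and p. 127 «we see that `(Y^σ)~ = Ỹ^f` for every object `Y` rational
over `L`») one prime `𝔓` of good reduction is fixed for the CM abelian variety `A`, the class representatives `A_i` AND the
conjugate `A^σ`, together with the reductions modulo `𝔓` of all homomorphisms among them ([Shimura1998] §11.1 Prop. 12).  In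
the tree's two-speed design these are four kinds of DATA: `GoodReductionAt` (`R i`), `HomReduction (R i) (R j)`, and the two
companions `HomReduction (R i) ((R a).conjFrob γ …)`, `HomReduction ((R a).conjFrob γ …) (R i)` against the Frobenius-conjugate
datum of `AbelianVarietyGoodReductionConjugate` (model `𝒳_a ⊗_{γᵥ} 𝓞_v`, reduction `Ã_a^{(q)}` by definition) — exactly the
binders of the Tate-compatibility fact (F-S5c).  `AbelianVarietyGoodReductionHomCofinite` produces the first two; this file
produces all four at once, for the SAME data `R`, at every place outside a finite set.

* §1 `isMonHom_app_of_comp_comp` — monoidal plumbing: the component at a group object of a natural isomorphism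
  `F ⋙ G ≅ F′ ⋙ G′` of cartesian-monoidal functors is a homomorphism for the ITERATED transported group structures (Mathlib
  `Functor.mapGrpCompIso`, `Functor.mapGrpNatIso`).
* §2 `GoodReductionAt.HomReduction.nonempty_of_mappingProperty` — the DATUM-INTRINSIC pair constructor: for two data `R`, `S`
  whose models are group schemes with group-scheme identifications of the generic and special fibres, `R`-model smooth,
  `S`-model separated with the Néron mapping property at the source `R`-model, there is a `HomReduction R S` — `liftHom` the
  Néron lift ([BombieriGubler2006] 10.3.9), a homomorphism because the generic fibre reflects homomorphisms
  (`isMonHom_of_isMonHom_genericFibre_map₂`), `redHom` its special fibre read through the identifications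
  ([Shimura1998] §11.1 Prop. 12), the `redEnd` compatibilities by uniqueness against the data's own pins.
* §3 `GoodReductionAt.conjOfSquares_grpPackage` — the conjugate datum `conjOfSquares R γ γᵥ h₁ p n h₂` of such an `R` again has a
  proper smooth GROUP-scheme model (structure transported along `γᵥ^*`) with group-scheme identifications (§1 applied to
  `conjGenericNatIso`, `conjReductionNatIso`).
* (imported, B-p12's `AbelianVarietyGoodReductionProducedGroup`) `exists_goodReductionAt_grpObj_of_isAbelianSchemeModel` —
  the datum produced from an abelian-scheme model (`AbelianVarietyGoodReductionCofinite`) with its group package exposed.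
* §4 ★ `exists_finite_forall_exists_goodReductionAt_homReduction_conjFrob` — the `FactRH′` body: cofinitely, data `R i` with
  `HomReduction (R i) (R j)` for all pairs and, for every arithmetic Frobenius `γ` at `v` over any subfield `F₀` and every member
  `a`, both companions against `(R a).conjFrob γ hγ p n hq` (the Néron mapping property of the proper smooth target model,
  `isNeronModel_of_isProper_of_smooth`, on either side).

HC_CM is proved only modulo the 7 printed citations until rung 0 closes.

## References

* [Shimura1998] G. Shimura, *Abelian Varieties with Complex Multiplication and Modular Functions* (1998), §11.1 Prop. 12; §18.6,
  proof of Thm. 18.6, pp. 126–127.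
* [BombieriGubler2006] E. Bombieri, W. Gubler, *Heights in Diophantine Geometry* (2006), 10.3.9 (p. 334).
* [BLRNeronModels1990] S. Bosch, W. Lütkebohmert, M. Raynaud, *Néron Models* (1990), Prop. 1.2/8.
* [SerreTate1968GoodReduction] J.-P. Serre, J. Tate, *Good reduction of abelian varieties*, Ann. of Math. 88 (1968), §1.
* [GortzWedhorn2020] U. Görtz, T. Wedhorn, *Algebraic Geometry I*, 2nd ed. (2020), Prop. 4.16, §(4.7), Prop. 9.19, Lemma 14.6.
* [Artin1986NeronModels] M. Artin, *Néron Models*, in Cornell–Silverman (1986), (1.1), Cor. (1.4).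
-/

set_option autoImplicit false

noncomputable section

open CategoryTheory CategoryTheory.Limits AlgebraicGeometry IsDedekindDomain IsDedekindDomain.HeightOneSpectrum MonoidalCategory
open scoped NumberField CategoryTheory.Obj
open Literature.NumberTheory.EllipticCurves (genericFibre specGenericPoint IsNeronModel map_genericFibre_injective
  isNeronModel_of_isProper_of_smooth)
open Literature.NumberTheory.DiophantineGeometry (IsAbelianSchemeModel specialFibreFunctor)

namespace Literature.AlgebraicGeometry.Motives

namespace AbelianVariety

/-! ### §1. Monoidal plumbing: components of natural isomorphisms of composite base changes are homomorphisms -/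

section Monoidal

universe v₁ v₂ v₃ v₄ u₁ u₂ u₃ u₄

variable {C : Type u₁} [Category.{v₁} C] [CartesianMonoidalCategory C]
  {D : Type u₂} [Category.{v₂} D] [CartesianMonoidalCategory D]
  {D' : Type u₃} [Category.{v₃} D'] [CartesianMonoidalCategory D']
  {E : Type u₄} [Category.{v₄} E] [CartesianMonoidalCategory E]

/-- For cartesian-monoidal functors `F, G, F′, G′` and a natural isomorphism `α : F ⋙ G ≅ F′ ⋙ G′`, the component
`α_X : G (F X) ⟶ G′ (F′ X)` at a group object `X` is a homomorphism for the ITERATED induced group structures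
(`Functor.grpObjObj` twice on each side): it underlies the isomorphism of group objects
`mapGrpCompIso⁻¹ ≫ mapGrpNatIso α ≫ mapGrpCompIso` (natural transformations of cartesian-monoidal functors are monoidal).
[folklore] -/
private theorem isMonHom_app_of_comp_comp (F : C ⥤ D) (G : D ⥤ E) (F' : C ⥤ D') (G' : D' ⥤ E)
    [F.Monoidal] [G.Monoidal] [F'.Monoidal] [G'.Monoidal] (α : F ⋙ G ≅ F' ⋙ G') (X : C) [GrpObj X] :
    @IsMonHom E _ _ (G.obj (F.obj X)) (G'.obj (F'.obj X)) (Functor.monObjObj (F := G) (X := F.obj X))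
      (Functor.monObjObj (F := G') (X := F'.obj X)) (α.hom.app X) := by
  let I : (F.mapGrp ⋙ G.mapGrp).obj (Grp.mk X) ≅ (F'.mapGrp ⋙ G'.mapGrp).obj (Grp.mk X) :=
    ((Functor.mapGrpCompIso (F := F) (G := G)).symm ≪≫ Functor.mapGrpNatIso α ≪≫
      Functor.mapGrpCompIso (F := F') (G := G')).app (Grp.mk X)
  have hI : IsMonHom I.hom.hom.hom := inferInstance
  have h : I.hom.hom.hom = α.hom.app X := by
    simp only [I, Iso.trans_hom, Iso.symm_hom, Iso.app_hom, NatTrans.comp_app, Grp.comp_hom_hom,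
      Functor.mapGrpCompIso_inv_app_hom_hom, Functor.mapGrpNatIso_hom_app_hom_hom,
      Functor.mapGrpCompIso_hom_app_hom_hom]
    exact (Category.id_comp _).trans (Category.comp_id _)
  rw [h] at hI
  exact hI

/-- Composition of homomorphisms, with the `IsMonHom` hypotheses explicit (term-mode glue for structures that are only
definitionally, not syntactically, the instances found by class resolution). [folklore] -/
private theorem isMonHom_comp_of_isMonHom {M N O : C} {iM : MonObj M} {iN : MonObj N} {iO : MonObj O} {f : M ⟶ N}
    {g : N ⟶ O} (hf : IsMonHom f) (hg : IsMonHom g) : IsMonHom (f ≫ g) :=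
  instIsMonHomComp f g

end Monoidal

/-! ### §2. The datum-intrinsic pair constructor: Néron lift ⇒ `HomReduction R S` -/

namespace GoodReductionAt

variable {K : Type} [Field K] [NumberField K] {A₀ B₀ : AbelianVariety K} {v : HeightOneSpectrum (𝓞 K)}

open scoped MonObj in
/-- **Reduction of homomorphisms from the Néron mapping property, for data with group-scheme models.**  Let `R`, `S` be
good-reduction data of `A₀`, `B₀` at `v` whose models `𝒳 = R.model.total`, `𝒴 = S.model.total` carry group-scheme structures
for which the generic-fibre identifications `𝒳_K ≅ A₀`, `𝒴_K ≅ B₀` and the special-fibre identifications `Ā ≅ 𝒳_κ`,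
`B̄ ≅ 𝒴_κ` are isomorphisms OF GROUP SCHEMES, with `𝒳` smooth, `𝒴` separated, and `𝒴` having the Néron mapping property at
the source `𝒳` (restriction to the generic fibre `Hom_{𝓞_v}(𝒳, 𝒴) → Hom_K(𝒳_K, 𝒴_K)` bijective).  Then there is a
reduction-of-homomorphisms datum `HomReduction R S`: `liftHom λ` := the unique extension of `λ` ([BombieriGubler2006] 10.3.9
«a morphism `Y_K → A` … is a morphism»), a homomorphism since the generic fibre reflects homomorphisms
(`isMonHom_of_isMonHom_genericFibre_map₂`); `redHom λ = λ̃` := its special fibre read through the two identifications, an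
additive map into `Hom(Ā, B̄)` ([Shimura1998] §11.1 Prop. 12); the compatibilities `(e ≫ λ)~ = ẽ ≫ λ̃`, `(λ ≫ g)~ = λ̃ ≫ g̃` with
`R.redEnd`, `S.redEnd` by UNIQUENESS of the extension against the data's own generic-fibre pins (`liftEnd_left_comp`) and
special-fibre pins (`redEnd_left_comp`). [cite: Shimura1998, §11.1 Prop. 12 (p. 83; held chunk p0109 L3)]
[cite: BombieriGubler2006, 10.3.9 (p. 334)] [cite: BLRNeronModels1990, Prop. 1.2/8] -/
theorem HomReduction.nonempty_of_mappingProperty (R : A₀.GoodReductionAt v) (S : B₀.GoodReductionAt v)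
    [GrpObj R.model.total] [GrpObj S.model.total] [Smooth R.model.total.hom] [IsSeparated S.model.total.hom]
    (hR : @IsMonHom _ _ _ _ _
      (Functor.monObjObj (F := genericFibre (valuationSubringAtPrime K v) K) (X := R.model.total)) _
      R.model.genericIso.hom)
    (hS : @IsMonHom _ _ _ _ _
      (Functor.monObjObj (F := genericFibre (valuationSubringAtPrime K v) K) (X := S.model.total)) _
      S.model.genericIso.hom)
    (hR' : @IsMonHom _ _ _ _ _ _ (Functor.monObjObj (F := specialFibreFunctor v) (X := R.model.total))
      R.reductionIso.hom)
    (hS' : @IsMonHom _ _ _ _ _ _ (Functor.monObjObj (F := specialFibreFunctor v) (X := S.model.total))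
      S.reductionIso.hom)
    (hN : Function.Bijective fun g : R.model.total ⟶ S.model.total =>
      (genericFibre (valuationSubringAtPrime K v) K).map g) :
    Nonempty (HomReduction R S) := by
  classical
  -- the four identifications, typed through the (special-/generic-) fibre functors, and their group-hom instances
  let eR : (genericFibre (valuationSubringAtPrime K v) K).obj R.model.total ≅ A₀.X := R.model.genericIso
  let eS : (genericFibre (valuationSubringAtPrime K v) K).obj S.model.total ≅ B₀.X := S.model.genericIso
  let ρR : R.reduction.X ≅ (specialFibreFunctor v).obj R.model.total := R.reductionIso
  let ρS : S.reduction.X ≅ (specialFibreFunctor v).obj S.model.total := S.reductionIso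
  haveI : IsMonHom eR.hom := hR
  haveI : IsMonHom eS.hom := hS
  haveI : IsMonHom ρR.hom := hR'
  haveI : IsMonHom ρS.hom := hS'
  -- the Néron bijection of `𝒴` at the smooth source `𝒳`, and the lift
  let Φ : (R.model.total ⟶ S.model.total) ≃
      ((genericFibre (valuationSubringAtPrime K v) K).obj R.model.total ⟶
        (genericFibre (valuationSubringAtPrime K v) K).obj S.model.total) := Equiv.ofBijective _ hN
  let L : (A₀ ⟶ B₀) → (R.model.total ⟶ S.model.total) := fun f => Φ.symm (eR.hom ≫ f.hom.hom.hom ≫ eS.inv)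
  have hL : ∀ f : A₀ ⟶ B₀, (genericFibre (valuationSubringAtPrime K v) K).map (L f) =
      eR.hom ≫ f.hom.hom.hom ≫ eS.inv := fun f => Φ.apply_symm_apply _
  have hinj : Function.Injective fun g : R.model.total ⟶ S.model.total =>
      (genericFibre (valuationSubringAtPrime K v) K).map g := hN.1
  have hLmon : ∀ f : A₀ ⟶ B₀, IsMonHom (L f) := fun f => by
    haveI : IsMonHom ((genericFibre (valuationSubringAtPrime K v) K).map (L f)) := by
      rw [hL]; infer_instance
    exact isMonHom_of_isMonHom_genericFibre_map₂ K R.model.total S.model.total (L f)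
  -- generic fibres of the data's own endomorphism lifts
  have hLR : ∀ e : End A₀, (genericFibre (valuationSubringAtPrime K v) K).map (R.liftEnd e : _ ⟶ _) =
      eR.hom ≫ (e : A₀ ⟶ A₀).hom.hom.hom ≫ eR.inv := fun e => by
    have h' : (genericFibre (valuationSubringAtPrime K v) K).map (R.liftEnd e : _ ⟶ _) ≫ eR.hom =
        eR.hom ≫ (e : A₀ ⟶ A₀).hom.hom.hom := R.map_liftEnd_comp_genericIso_hom e
    rw [← Category.assoc, ← h', Category.assoc, Iso.hom_inv_id, Category.comp_id]
  have hLS : ∀ g : End B₀, (genericFibre (valuationSubringAtPrime K v) K).map (S.liftEnd g : _ ⟶ _) =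
      eS.hom ≫ (g : B₀ ⟶ B₀).hom.hom.hom ≫ eS.inv := fun g => by
    have h' : (genericFibre (valuationSubringAtPrime K v) K).map (S.liftEnd g : _ ⟶ _) ≫ eS.hom =
        eS.hom ≫ (g : B₀ ⟶ B₀).hom.hom.hom := S.map_liftEnd_comp_genericIso_hom g
    rw [← Category.assoc, ← h', Category.assoc, Iso.hom_inv_id, Category.comp_id]
  -- special fibres of the data's own endomorphism reductions
  have hρR : ∀ e : End A₀, (R.redEnd e : R.reduction ⟶ R.reduction).hom.hom.hom ≫ ρR.hom =
      ρR.hom ≫ (specialFibreFunctor v).map (R.liftEnd e : _ ⟶ _) := fun e => R.redEnd_comp_reductionIso_hom e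
  have hρS : ∀ g : End B₀, (S.redEnd g : S.reduction ⟶ S.reduction).hom.hom.hom ≫ ρS.hom =
      ρS.hom ≫ (specialFibreFunctor v).map (S.liftEnd g : _ ⟶ _) := fun g => S.redEnd_comp_reductionIso_hom g
  -- uniqueness: additivity and the two compatibilities of the lift
  have hLadd : ∀ f g : A₀ ⟶ B₀, L (f + g) = L f * L g := fun f g => hinj (by
    change (genericFibre _ K).map (L (f + g)) = (genericFibre _ K).map (L f * L g)
    rw [Functor.map_mul, hL, hL, hL]
    change eR.hom ≫ (f.hom * g.hom).hom.hom ≫ eS.inv = _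
    rw [Grp.Hom.hom_mul, Mon.Hom.hom_mul, MonObj.mul_comp, MonObj.comp_mul])
  have hLpre : ∀ (e : End A₀) (f : A₀ ⟶ B₀), L ((e : A₀ ⟶ A₀) ≫ f) = (R.liftEnd e : _ ⟶ _) ≫ L f :=
      fun e f => hinj (by
    change (genericFibre _ K).map (L (e ≫ f)) = (genericFibre _ K).map ((R.liftEnd e : _ ⟶ _) ≫ L f)
    rw [CategoryTheory.Functor.map_comp, hL, hL, hLR, AbelianVariety.comp_hom, Grp.comp_hom_hom]
    simp)
  have hLpost : ∀ (f : A₀ ⟶ B₀) (g : End B₀), L (f ≫ (g : B₀ ⟶ B₀)) = L f ≫ (S.liftEnd g : _ ⟶ _) :=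
      fun f g => hinj (by
    change (genericFibre _ K).map (L (f ≫ g)) = (genericFibre _ K).map (L f ≫ (S.liftEnd g : _ ⟶ _))
    rw [CategoryTheory.Functor.map_comp, hL, hL, hLS, AbelianVariety.comp_hom, Grp.comp_hom_hom]
    simp)
  -- the reduction of homomorphisms: the special fibre of the lift, read through `ρR`, `ρS`
  let r : (A₀ ⟶ B₀) → (R.reduction ⟶ S.reduction) := fun f =>
    haveI := hLmon f
    InducedCategory.homMk (Grp.homMk (ρR.hom ≫ (specialFibreFunctor v).map (L f) ≫ ρS.inv))
  have hr : ∀ f, (r f).hom.hom.hom = ρR.hom ≫ (specialFibreFunctor v).map (L f) ≫ ρS.inv := fun f => rfl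
  have hradd : ∀ f g, r (f + g) = r f + r g := fun f g => by
    apply AbelianVariety.hom_ext
    rw [AbelianVariety.hom_add, Grp.Hom.hom_mul, Mon.Hom.hom_mul, hr, hr, hr, hLadd, Functor.map_mul,
      MonObj.mul_comp, MonObj.comp_mul]
  have hr0 : r 0 = 0 := by
    have h0 := hradd 0 0
    rw [add_zero] at h0
    exact left_eq_add.mp h0
  refine ⟨{ liftHom := L
            liftHom_left_comp := fun f => ?_
            redHom := { toFun := r, map_zero' := hr0, map_add' := hradd }
            redHom_left_comp := fun f => ?_
            redEnd_comp_redHom := fun e f => ?_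
            redHom_comp_redEnd := fun f g => ?_ }⟩
  · -- generic fibre of the lift
    have h1 : (genericFibre (valuationSubringAtPrime K v) K).map (L f) ≫ eS.hom = eR.hom ≫ f.hom.hom.hom := by
      rw [hL]; simp
    have h2 := congrArg CommaMorphism.left h1
    simp only [Over.comp_left] at h2
    exact h2
  · -- special fibre of the lift
    have h1 : (ρR.hom ≫ (specialFibreFunctor v).map (L f) ≫ ρS.inv) ≫ ρS.hom =
        ρR.hom ≫ (specialFibreFunctor v).map (L f) := by simp
    have h2 := congrArg CommaMorphism.left h1
    simp only [Over.comp_left] at h2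
    exact h2
  · -- `(e ≫ f)~ = ẽ ≫ f̃`
    apply AbelianVariety.hom_ext
    change (r (e ≫ f)).hom.hom.hom = (R.redEnd e : R.reduction ⟶ R.reduction).hom.hom.hom ≫ (r f).hom.hom.hom
    rw [hr, hr, hLpre, CategoryTheory.Functor.map_comp, reassoc_of% (hρR e)]
    simp only [Category.assoc]
  · -- `(f ≫ g)~ = f̃ ≫ g̃`
    apply AbelianVariety.hom_ext
    change (r (f ≫ g)).hom.hom.hom = (r f).hom.hom.hom ≫ (S.redEnd g : S.reduction ⟶ S.reduction).hom.hom.hom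
    have hg : ρS.inv ≫ (S.redEnd g : S.reduction ⟶ S.reduction).hom.hom.hom =
        (specialFibreFunctor v).map (S.liftEnd g : _ ⟶ _) ≫ ρS.inv := by
      rw [Iso.inv_comp_eq, ← Category.assoc, Iso.eq_comp_inv]
      exact hρS g
    rw [hr, hr, hLpost, CategoryTheory.Functor.map_comp, Category.assoc, Category.assoc, Category.assoc, hg]

end GoodReductionAt

/-! ### §3. The conjugate datum `conjOfSquares` has a group-scheme model, and its identifications are homomorphisms -/

namespace GoodReductionAt

variable {K : Type} [Field K] [NumberField K] {A₀ : AbelianVariety K} {v : HeightOneSpectrum (𝓞 K)}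

/-- **The conjugate model is again a proper smooth GROUP-scheme model, with group-scheme identifications.**  Let `R` be a
good-reduction datum of `A₀` at `v` whose model `𝒳` carries a group-scheme structure for which `𝒳_K ≅ A₀` and `Ā ≅ 𝒳_κ`
are group isomorphisms, `𝒳` smooth and proper (a PRODUCED datum).  For an automorphism `γᵥ` of `𝓞_{K,v}` over `γ` reducing
to `Frobⁿ` on `κ(v)`, the conjugate datum `conjOfSquares R γ γᵥ h₁ p n h₂` of `A₀^γ` (model `𝒳 ⊗_{γᵥ} 𝓞_v`, reduction
`Ã^{(q)}`) has the same properties: its model is a group scheme (structure transported along the cartesian-monoidal base change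
`γᵥ^*`), smooth and proper (base change, `isSmoothProper_conjModel`), and its generic-fibre identification
`(𝒳 ⊗_{γᵥ} 𝓞_v)_K ≅ (𝒳_K)^γ ≅ A₀^γ` and special-fibre identification `Ã^{(q)} ≅ (𝒳_κ)^{(q)} ≅ (𝒳 ⊗_{γᵥ} 𝓞_v)_κ` are GROUP
isomorphisms (components of natural isomorphisms of cartesian-monoidal functors, `isMonHom_app_of_comp_comp`).
[cite: Shimura1998, §18.6 proof of Thm. 18.6 (reduction modulo `𝔓`), p. 127 («(Y^σ)~ = Ỹ^f for every object Y»)] [cite: GortzWedhorn2020, Prop. 4.16 and §(4.7)] -/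
theorem conjOfSquares_grpPackage (R : A₀.GoodReductionAt v) [GrpObj R.model.total] [Smooth R.model.total.hom]
    [IsProper R.model.total.hom]
    (hR : @IsMonHom _ _ _ _ _
      (Functor.monObjObj (F := genericFibre (valuationSubringAtPrime K v) K) (X := R.model.total)) _
      R.model.genericIso.hom)
    (hR' : @IsMonHom _ _ _ _ _ _ (Functor.monObjObj (F := specialFibreFunctor v) (X := R.model.total))
      R.reductionIso.hom)
    (γ : K ≃+* K) (γᵥ : valuationSubringAtPrime K v ≃+* valuationSubringAtPrime K v)
    (h₁ : (algebraMap (valuationSubringAtPrime K v) K).comp γᵥ.toRingHom =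
      γ.toRingHom.comp (algebraMap (valuationSubringAtPrime K v) K))
    (p n : ℕ) [ExpChar v.asIdeal.ResidueField p]
    (h₂ : (residueAt v).comp γᵥ.toRingHom = (iterateFrobenius v.asIdeal.ResidueField p n).comp (residueAt v)) :
    ∃ (_ : GrpObj (conjOfSquares R γ γᵥ h₁ p n h₂).model.total),
      Smooth (conjOfSquares R γ γᵥ h₁ p n h₂).model.total.hom ∧
      IsProper (conjOfSquares R γ γᵥ h₁ p n h₂).model.total.hom ∧
      @IsMonHom _ _ _ _ _
        (Functor.monObjObj (F := genericFibre (valuationSubringAtPrime K v) K)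
          (X := (conjOfSquares R γ γᵥ h₁ p n h₂).model.total)) _
        (conjOfSquares R γ γᵥ h₁ p n h₂).model.genericIso.hom ∧
      @IsMonHom _ _ _ _ _ _
        (Functor.monObjObj (F := specialFibreFunctor v) (X := (conjOfSquares R γ γᵥ h₁ p n h₂).model.total))
        (conjOfSquares R γ γᵥ h₁ p n h₂).reductionIso.hom := by
  -- the identifications of `R`, typed through the fibre functors, as group isomorphisms
  let eR : (genericFibre (valuationSubringAtPrime K v) K).obj R.model.total ≅ A₀.X := R.model.genericIso
  let ρR : R.reduction.X ≅ (specialFibreFunctor v).obj R.model.total := R.reductionIso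
  haveI : IsMonHom eR.hom := hR
  haveI : IsMonHom ρR.hom := hR'
  -- the transported group structure on `𝒳 ⊗_{γᵥ} 𝓞_v = (Over.pullback (Spec γᵥ)).obj 𝒳`
  let instC : GrpObj (conjOfSquares R γ γᵥ h₁ p n h₂).model.total :=
    Functor.grpObjObj (F := Over.pullback (Spec.map (CommRingCat.ofHom γᵥ.toRingHom))) (G := R.model.total)
  refine ⟨instC, ?_, ?_, ?_, ?_⟩
  · -- smooth (base change)
    haveI : SmoothOfRelativeDimension (A₀.conjugate γ).dim (conjOfSquares R γ γᵥ h₁ p n h₂).model.total.hom :=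
      (isSmoothProper_conjModel R γ γᵥ h₁).1
    exact SmoothOfRelativeDimension.smooth (A₀.conjugate γ).dim _
  · -- proper (base change)
    exact (isSmoothProper_conjModel R γ γᵥ h₁).2
  · -- the generic-fibre identification `(conjGenericNatIso).app 𝒳 ≫ γ^*(e)` is a homomorphism
    have h1 := isMonHom_app_of_comp_comp (Over.pullback (Spec.map (CommRingCat.ofHom γᵥ.toRingHom)))
      (genericFibre (valuationSubringAtPrime K v) K) (genericFibre (valuationSubringAtPrime K v) K)
      (Over.pullback (Spec.map (CommRingCat.ofHom γ.toRingHom))) (conjGenericNatIso γ γᵥ h₁) R.model.total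
    have h2 : IsMonHom ((Over.pullback (Spec.map (CommRingCat.ofHom γ.toRingHom))).map eR.hom) := inferInstance
    exact isMonHom_comp_of_isMonHom h1 h2
  · -- the special-fibre identification `Frob^*(ρ) ≫ (conjReductionNatIso).app 𝒳` is a homomorphism
    have h1 : IsMonHom ((Over.pullback (frobSpec v.asIdeal.ResidueField p n)).map ρR.hom) := inferInstance
    have h2 := isMonHom_app_of_comp_comp (specialFibreFunctor v) (Over.pullback (frobSpec v.asIdeal.ResidueField p n))
      (Over.pullback (Spec.map (CommRingCat.ofHom γᵥ.toRingHom))) (specialFibreFunctor v)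
      (conjReductionNatIso γᵥ p n h₂) R.model.total
    exact isMonHom_comp_of_isMonHom h1 h2

end GoodReductionAt

/-! ### §4. The companions edition of `FactHR`: cofinite produced data WITH the Frobenius-conjugate companions -/

section Companions

variable {K : Type} [Field K] [NumberField K]

/-- ★ **Reduction of homomorphisms at all but finitely many places, WITH the Frobenius-conjugate companions (`FactRH′`).**
For a finite family `A i` of abelian varieties over a number field `K` there is a finite set `S` of finite places such that at
every `v ∉ S` there are good-reduction data `R i : (A i).GoodReductionAt v` admitting (a) reduction-of-homomorphisms data
`HomReduction (R i) (R j)` for all pairs and (b) for every subfield `F₀`, every arithmetic Frobenius `γ ∈ Aut(K/F₀)` at `v`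
(`q = pⁿ`) and every member `a`, reduction-of-homomorphisms data between each `R i` and the Frobenius-CONJUGATE datum
`(R a).conjFrob γ hγ p n hq` of `(A a)^γ` (model `𝒳_a ⊗_{γᵥ} 𝓞_v`, reduction `Ã_a^{(q)}`) in BOTH directions — the four kinds
of data bound by the Tate-compatibility fact (F-S5c) of the main theorem of complex multiplication ([Shimura1998] §18.6, proof of
Thm. 18.6, pp. 126–127: a prime of good reduction for `A`, the `A_i` and their conjugates, with the reductions of all
homomorphisms among them; p. 127 «`(Y^σ)~ = Ỹ^f` for every object `Y` rational over `L`»; §11.1 Prop. 12).  Proof: outside the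
union of the finitely many exceptional sets, abelian-scheme models exist (`exists_finite_forall_exists_isAbelianSchemeModel`,
[SerreTate1968GoodReduction] §1); the data PRODUCED from them have group-scheme models with group-scheme identifications
(`exists_goodReductionAt_grpObj_of_isAbelianSchemeModel`), and so do their Frobenius conjugates (`conjOfSquares_grpPackage`);
every such pair of data carries a `HomReduction` by the Néron mapping property of the proper smooth target model
(`isNeronModel_of_isProper_of_smooth`, [BLRNeronModels1990] 1.2/8) — `HomReduction.nonempty_of_mappingProperty`.
[cite: Shimura1998, §11.1 Prop. 12 (p. 83; held chunk p0109 L3) and §18.6 proof of Thm. 18.6, pp. 126–127]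
[cite: BombieriGubler2006, 10.3.9 (p. 334)] [cite: SerreTate1968GoodReduction, §1] [cite: BLRNeronModels1990, Prop. 1.2/8] -/
theorem exists_finite_forall_exists_goodReductionAt_homReduction_conjFrob
    {K : Type} [Field K] [NumberField K] {ι : Type} [Finite ι] (A : ι → AbelianVariety K) :
    ∃ S : Set (HeightOneSpectrum (𝓞 K)), S.Finite ∧ ∀ v ∉ S, ∃ R : ∀ i, (A i).GoodReductionAt v,
      (∀ i j, Nonempty (GoodReductionAt.HomReduction (R i) (R j))) ∧
      ∀ {F₀ : Type} [Field F₀] [NumberField F₀] [Algebra F₀ K] (a : ι) (γ : K ≃ₐ[F₀] K)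
        (hγ : IsArithFrobAt (𝓞 F₀) γ v.asIdeal) (p n : ℕ) [ExpChar v.asIdeal.ResidueField p]
        (hq : Nat.card (𝓞 F₀ ⧸ v.asIdeal.under (𝓞 F₀)) = p ^ n),
        (∀ i, Nonempty (GoodReductionAt.HomReduction (R i) ((R a).conjFrob γ hγ p n hq))) ∧
        (∀ i, Nonempty (GoodReductionAt.HomReduction ((R a).conjFrob γ hγ p n hq) (R i))) := by
  classical
  choose S hS hmod using fun i => exists_finite_forall_exists_isAbelianSchemeModel (A i)
  refine ⟨⋃ i, S i, Set.finite_iUnion hS, fun v hv => ?_⟩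
  have hv' : ∀ i, v ∉ S i := fun i hvi => hv (Set.mem_iUnion.mpr ⟨i, hvi⟩)
  choose 𝒜 inst h𝒜 using fun i => hmod i v (hv' i)
  -- the produced data with their group packages
  choose R instR hsm hpr hgen hred _hspec using
    fun i => exists_goodReductionAt_grpObj_of_isAbelianSchemeModel (h𝒜 i)
  haveI : ∀ i, Smooth (R i).model.total.hom := hsm
  haveI : ∀ i, IsProper (R i).model.total.hom := hpr
  refine ⟨R, fun i j => ?_, fun {F₀} _ _ _ a γ hγ p n _ hq => ?_⟩
  · -- (a) the family pairs: Néron property of the target model at the smooth source model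
    exact GoodReductionAt.HomReduction.nonempty_of_mappingProperty (R i) (R j) (hgen i) (hgen j) (hred i) (hred j)
      ((isNeronModel_of_isProper_of_smooth _ K (R j).model.total).mappingProperty (R i).model.total inferInstance)
  · -- (b) the Frobenius-conjugate companions (`conjFrob = conjOfSquares …` for the induced automorphism `γᵥ` of `𝓞_v`)
    obtain ⟨instC, hsmC, hprC, hgenC, hredC⟩ := GoodReductionAt.conjOfSquares_grpPackage (R a) (hgen a) (hred a)
      γ.toRingEquiv (algEquivValuationSubring v γ (smul_asIdeal_eq_of_isArithFrobAt v γ hγ))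
      (algebraMap_comp_algEquivValuationSubring v γ _) p n (residueAt_comp_algEquivValuationSubring v γ hγ p n hq)
    -- register the package under the `conjFrob` spelling of the head (definitionally `conjOfSquares …`)
    letI : GrpObj ((R a).conjFrob γ hγ p n hq).model.total := instC
    haveI : Smooth ((R a).conjFrob γ hγ p n hq).model.total.hom := hsmC
    haveI : IsProper ((R a).conjFrob γ hγ p n hq).model.total.hom := hprC
    refine ⟨fun i => ?_, fun i => ?_⟩
    · exact GoodReductionAt.HomReduction.nonempty_of_mappingProperty (R i) ((R a).conjFrob γ hγ p n hq) (hgen i) hgenC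
        (hred i) hredC
        ((isNeronModel_of_isProper_of_smooth _ K ((R a).conjFrob γ hγ p n hq).model.total).mappingProperty
          (R i).model.total inferInstance)
    · exact GoodReductionAt.HomReduction.nonempty_of_mappingProperty ((R a).conjFrob γ hγ p n hq) (R i) hgenC (hgen i)
        hredC (hred i)
        ((isNeronModel_of_isProper_of_smooth _ K (R i).model.total).mappingProperty
          ((R a).conjFrob γ hγ p n hq).model.total inferInstance)

end Companions

end AbelianVariety

end Literature.AlgebraicGeometry.Motives

end
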